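import Summits.QuantumFields.BalabanUV.Beta.EriceFlowEnclosureGevreySectorAlgebra
import Mathlib.RingTheory.PowerSeries.Basic
import Mathlib.Analysis.SpecificLimits.Basic
import Mathlib.Analysis.Normed.Group.InfiniteSum
import Mathlib.Analysis.SpecificLimits.Normed
import Mathlib.Analysis.SpecialFunctions.Exponential
import Mathlib.Analysis.SpecialFunctions.Complex.LogBounds

/-!
# Beta / EriceFlowEnclosureGevreyComposition — SERVICE: Gevrey-1 expansions (‖f z − Σ_{k<N} a_k z^k‖ ≤ C·K^N·N!·‖z‖^N for EVERY N,
# at one point z) are CLOSED UNDER POST-COMPOSITION WITH ANALYTIC GERMS — powers (`gevrey_pow`: g^j keeps the class with the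
# constant (C + 3L)^j and the SAME K, letters = the power-series coefficients of (Σ b_k X^k)^j) and `gevrey_comp`: for φ(w) = Σ c_j w^j
# with |c_j| ≤ M∕ρ^j and a Gevrey-1 g = O(z) with 2‖g z‖ ≤ ρ, the value φ(g z) = Σ_j c_j (g z)^j has the Gevrey-1 expansion whose
# letters are the FORMAL COMPOSITION Σ_{j≤n} c_j·[X^n](Σ_k b_k X^k)^j, with explicit constants, uniformly in the order N
# (bflow-p3 gen 37; MODULE 33 — the closure rule that MODULE 31's HONEST list left open: «composition with general analytic
# functions (only exp is done)»; exp (31b), the reciprocal (32k-a) and the logarithm (32l ∕ 32m) are the instances φ = exp,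
# φ(w) = 1∕(a₀ + w), φ(w) = log(1 + w)).

WHAT.  MODULES 28–32 built the Gevrey-1 dictionary of the β-flow on road (H) object by object: letters (28), real-chart asymptotics
(29–31: Λ_M, E, β̃ = b₀·exp E, s²Λ_M′ = exp(−E)), sectors and Watson (32).  Each transcendental step (exp in 31b, 1∕· in 32k-a, log
in 32m) was proved on its own.  This file is the ONE rule behind them, in the pointwise format of 32l `gevrey_mul` (so it serves the
real chart and the sectors alike):
  * §1 `coeff_pow_succ` ∕ `coeff_pow_eq_zero_of_lt` — the letters of g^j are the coefficients of the j-th power of the formal series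
    `PowerSeries.mk b`; with b₀ = 0 they vanish below degree j (so the composition letters are FINITE sums);
  * §2 `gevrey_pow` — if `‖g − Σ_{k<N} b_k z^k‖ ≤ C·K^N·N!·‖z‖^N` ∀N and `|b_k| ≤ L·E^k·k!`, then for every j and N
    `‖g^j − Σ_{n<N} [X^n](mk b)^j · z^n‖ ≤ (C + 3L)^j·max(K, E)^N·N!·‖z‖^N` (32l `gevrey_mul` iterated: the first factor's letters and
    remainders, the second factor's remainders — no letter bound on the powers is needed, so K does NOT degrade with j);
  * §3 `gevrey_comp` — with b₀ = 0, |c_j| ≤ M∕ρ^j, 2‖g‖ ≤ ρ and `HasSum (j ↦ c_j g^j) Φ`: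
    `‖Φ − Σ_{n<N} (Σ_{j≤n} c_j·[X^n](mk b)^j)·z^n‖ ≤ 3M·(2(1 + (C + 3L)∕ρ)·max(K, E) + C·K∕ρ)^N·N!·‖z‖^N` for every N — the finite part
    Σ_{j<N} c_j·(g^j − T_N g^j) by §2 and Σ_{j<N}((C+3L)∕ρ)^j ≤ (2(1 + (C+3L)∕ρ))^N, the tail Σ_{j≥N} c_j g^j by the geometric series
    (‖g‖∕ρ ≤ ½) and ‖g‖ ≤ C·K·‖z‖ (order 1, b₀ = 0).
PRESEARCH.  [corpus: book:loday-richaud2016 (Divergent Series, Summability and Resurgence II) Prop. 1.2.4 pp. 15–16: s-Gevrey SERIES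
are stable under composition with convergent ones; Prop. 1.2.12 p. 18: s-Gevrey asymptotic FUNCTIONS on a sector form a differential
algebra (via the derivative characterisation)] — here: pointwise ∀N-expansions, composition with an analytic germ through the power
rule, constants explicit and uniform in N; Mathlib: `PowerSeries.coeff_mul`, `hasSum_nat_add_iff'`, `HasSum.norm_le_of_bounded`,
`hasSum_geometric_of_lt_one`; Mathlib has no Gevrey ASYMPTOTIC-SERIES class; the tree's `Literature/Analysis/FluidPDE/Torus*Gevrey*`
∕ `FunctionSpaces/TorusGevrey*` files are Fourier-weight Gevrey REGULARITY bounds for Navier–Stokes (a different notion, no statement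
overlap); Gevrey-1 expansions in the present sense = this lineage's MODULES 28–32.
HONEST.  [folklore] elementary analysis and finite-sum algebra; no β-function, no `Conclusions S`; nothing of Bałaban's asserted;
NOT B12 Thm 2, NOT BetaPertH, NOT continuum, NOT Clay.
HONEST DEPENDENCY: continuum YM on T⁴ ⇐ BetaPertH ∧ nine spine estimates (0/9 proved); BetaPertH ⇐ (D1) ∧ (D4) ∧ CAP+tail;
G-an2-4 gates asym, D1 and NE2/3/4.
-/

noncomputable section

open Set Filter Topology Finset

open scoped Nat

namespace Summit.QuantumFields.BalabanUV.Beta.EriceFlowEnclosureGevreyComposition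

open Summit.QuantumFields.BalabanUV.Beta.EriceFlowEnclosureGevreySectorAlgebra (gevrey_mul)

/-! ## §1 Letters of powers: coefficients of `(PowerSeries.mk b)^j` -/

/-- **THE POWER LETTERS RECURSE BY CONVOLUTION**: `[X^n](mk b)^{j+1} = Σ_{i≤n} b_i·[X^{n−i}](mk b)^j` (`PowerSeries.coeff_mul` with
the antidiagonal written as a range sum) — exactly the convolution shape of 32l `gevrey_mul`'s product letters. [folklore] -/
theorem coeff_pow_succ (b : ℕ → ℝ) (j n : ℕ) :
    PowerSeries.coeff n ((PowerSeries.mk b) ^ (j + 1))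
      = ∑ i ∈ range (n + 1), b i * PowerSeries.coeff (n - i) ((PowerSeries.mk b) ^ j) := by
  rw [pow_succ', PowerSeries.coeff_mul, Nat.sum_antidiagonal_eq_sum_range_succ_mk]
  refine Finset.sum_congr rfl fun i _ => ?_
  rw [PowerSeries.coeff_mk]

/-- The zeroth power: `[X^n](mk b)^0 = [n = 0]`. [folklore] -/
theorem coeff_pow_zero (b : ℕ → ℝ) (n : ℕ) :
    PowerSeries.coeff n ((PowerSeries.mk b) ^ 0) = if n = 0 then 1 else 0 := by
  rw [pow_zero, PowerSeries.coeff_one]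

/-- **With b₀ = 0 the j-th power starts at degree j**: `[X^n](mk b)^j = 0` for `n < j` (induction on j through the convolution:
every term has either `b_0 = 0` or a lower power's coefficient below its degree). [folklore] -/
theorem coeff_pow_eq_zero_of_lt {b : ℕ → ℝ} (hb0 : b 0 = 0) :
    ∀ j n : ℕ, n < j → PowerSeries.coeff n ((PowerSeries.mk b) ^ j) = 0 := by
  intro j
  induction j with
  | zero => intro n hn; exact absurd hn (Nat.not_lt_zero n)
  | succ j ih =>
    intro n hn
    rw [coeff_pow_succ]
    refine Finset.sum_eq_zero fun i hi => ?_
    rcases Nat.eq_zero_or_pos i with h0 | hpos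
    · subst h0; rw [hb0, zero_mul]
    · have hi' : i ≤ n := Nat.lt_succ_iff.mp (Finset.mem_range.mp hi)
      have : n - i < j := by omega
      rw [ih (n - i) this, mul_zero]

/-! ## §2 Powers of a Gevrey-1 expansion -/

/-- **POWERS KEEP THE CLASS, K FIXED**: if at a point z `‖g − Σ_{k<N} b_k z^k‖ ≤ C·K^N·N!·‖z‖^N` for every N and `|b_k| ≤ L·E^k·k!`,
then for every j and every N `‖g^j − Σ_{n<N} [X^n](mk b)^j·z^n‖ ≤ (C + 3L)^j·max(K, E)^N·N!·‖z‖^N` — 32l `gevrey_mul` with the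
fixed first factor g (its letters and remainders) against g^j (its remainders only), so the exponent base never degrades.
[folklore; Loday-Richaud 2016, Prop. 1.2.12] -/
theorem gevrey_pow {b : ℕ → ℝ} {C K L E : ℝ} {g z : ℂ} (hC : 0 ≤ C) (hK : 0 < K) (hL : 0 ≤ L) (hE : 0 < E)
    (hb : ∀ k, |b k| ≤ L * (E ^ k * k !))
    (hg : ∀ N : ℕ, ‖g - ∑ k ∈ range N, ((b k : ℝ) : ℂ) * z ^ k‖ ≤ C * K ^ N * N ! * ‖z‖ ^ N) :
    ∀ j N : ℕ, ‖g ^ j - ∑ n ∈ range N, ((PowerSeries.coeff n ((PowerSeries.mk b) ^ j) : ℝ) : ℂ) * z ^ n‖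
      ≤ (C + 3 * L) ^ j * max K E ^ N * N ! * ‖z‖ ^ N := by
  set Km : ℝ := max K E with hKm
  have hKm0 : 0 < Km := lt_max_of_lt_left hK
  have hΘ : 0 ≤ C + 3 * L := by positivity
  intro j
  induction j with
  | zero =>
    intro N
    have hsum : ∑ n ∈ range N, ((PowerSeries.coeff n ((PowerSeries.mk b) ^ 0) : ℝ) : ℂ) * z ^ n
        = if N = 0 then 0 else 1 := by
      rcases Nat.eq_zero_or_pos N with h0 | hpos
      · subst h0; simp
      · rw [if_neg hpos.ne']
        rw [Finset.sum_eq_single_of_mem 0 (Finset.mem_range.mpr hpos)]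
        · rw [coeff_pow_zero]; simp
        · intro n _ hn
          rw [coeff_pow_zero, if_neg hn]; simp
    rw [pow_zero, hsum, pow_zero, one_mul]
    rcases Nat.eq_zero_or_pos N with h0 | hpos
    · subst h0; simp
    · rw [if_neg hpos.ne', sub_self, norm_zero]; positivity
  | succ j ih =>
    intro N
    have hmul := gevrey_mul (a := b) (b := fun n => PowerSeries.coeff n ((PowerSeries.mk b) ^ j))
      (f := g) (g := g ^ j) (z := z) hC hK (pow_nonneg hΘ j) hKm0 hL hE hb hg ih N
    have hmax : max (max K Km) E = Km := by
      rw [max_eq_right (le_max_left K E : K ≤ Km), max_eq_left (le_max_right K E : E ≤ Km)]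
    rw [hmax] at hmul
    have hcoef : ∀ n ∈ range N,
        ((∑ i ∈ range (n + 1), b i * (fun n => PowerSeries.coeff n ((PowerSeries.mk b) ^ j)) (n - i) : ℝ) : ℂ) * z ^ n
          = ((PowerSeries.coeff n ((PowerSeries.mk b) ^ (j + 1)) : ℝ) : ℂ) * z ^ n := by
      intro n _
      rw [coeff_pow_succ]
    rw [Finset.sum_congr rfl hcoef, ← pow_succ'] at hmul
    refine hmul.trans (le_of_eq ?_)
    ring

/-! ## §3 Composition with an analytic germ -/

/-- The order-1 reading: with b₀ = 0 the expansion's order-1 remainder says `‖g‖ ≤ C·K·‖z‖`. [folklore] -/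
theorem norm_le_of_order_one {b : ℕ → ℝ} {C K : ℝ} {g z : ℂ} (hb0 : b 0 = 0)
    (hg : ∀ N : ℕ, ‖g - ∑ k ∈ range N, ((b k : ℝ) : ℂ) * z ^ k‖ ≤ C * K ^ N * N ! * ‖z‖ ^ N) :
    ‖g‖ ≤ C * K * ‖z‖ := by
  have h := hg 1
  rw [Finset.sum_range_one, hb0] at h
  simpa using h

/-- **The composition letters are finite formal sums**: for n < N, `Σ_{j≤n} c_j·[X^n](mk b)^j = Σ_{j<N} c_j·[X^n](mk b)^j`
(the powers j > n do not reach degree n when b₀ = 0). [folklore] -/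
theorem compLetters_eq_sum_range {b : ℕ → ℝ} (hb0 : b 0 = 0) (c : ℕ → ℝ) {n N : ℕ} (hn : n < N) :
    ∑ j ∈ range (n + 1), c j * PowerSeries.coeff n ((PowerSeries.mk b) ^ j)
      = ∑ j ∈ range N, c j * PowerSeries.coeff n ((PowerSeries.mk b) ^ j) := by
  refine Finset.sum_subset
    (fun j hj => Finset.mem_range.mpr (lt_of_lt_of_le (Finset.mem_range.mp hj) (Nat.succ_le_of_lt hn)))
    fun j hj hjn => ?_
  have hlt : n < j := by
    have := Finset.mem_range.mp hj
    have h2 : ¬ j < n + 1 := fun h => hjn (Finset.mem_range.mpr h)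
    omega
  rw [coeff_pow_eq_zero_of_lt hb0 j n hlt, mul_zero]

/-- **THE TRUNCATION OF THE COMPOSITION IS THE COMPOSITION OF THE TRUNCATIONS**:
`Σ_{n<N} (Σ_{j≤n} c_j·[X^n](mk b)^j)·z^n = Σ_{j<N} c_j·(Σ_{n<N} [X^n](mk b)^j·z^n)` (b₀ = 0; `Finset.sum_comm`). [folklore] -/
theorem truncComp_eq {b : ℕ → ℝ} (hb0 : b 0 = 0) (c : ℕ → ℝ) (z : ℂ) (N : ℕ) :
    ∑ n ∈ range N, ((∑ j ∈ range (n + 1), c j * PowerSeries.coeff n ((PowerSeries.mk b) ^ j) : ℝ) : ℂ) * z ^ n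
      = ∑ j ∈ range N, ((c j : ℝ) : ℂ)
          * ∑ n ∈ range N, ((PowerSeries.coeff n ((PowerSeries.mk b) ^ j) : ℝ) : ℂ) * z ^ n := by
  have h1 : ∀ n ∈ range N,
      ((∑ j ∈ range (n + 1), c j * PowerSeries.coeff n ((PowerSeries.mk b) ^ j) : ℝ) : ℂ) * z ^ n
        = ∑ j ∈ range N, ((c j : ℝ) : ℂ) * (((PowerSeries.coeff n ((PowerSeries.mk b) ^ j) : ℝ) : ℂ) * z ^ n) := by
    intro n hn
    rw [compLetters_eq_sum_range hb0 c (Finset.mem_range.mp hn)]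
    push_cast
    rw [Finset.sum_mul]
    refine Finset.sum_congr rfl fun j _ => ?_
    ring
  rw [Finset.sum_congr rfl h1, Finset.sum_comm]
  refine Finset.sum_congr rfl fun j _ => ?_
  rw [Finset.mul_sum]

/-- **COMPOSITION WITH AN ANALYTIC GERM KEEPS THE CLASS (pointwise, explicit constants).**  Let g have the Gevrey-1 expansion
`‖g − Σ_{k<N} b_k z^k‖ ≤ C·K^N·N!·‖z‖^N` for every N at the point z, with b₀ = 0 and letters `|b_k| ≤ L·E^k·k!`; let φ(w) = Σ c_j w^j
have `|c_j| ≤ M∕ρ^j` (radius ≥ ρ > 0) and let the point be inside half the disc, `2‖g‖ ≤ ρ`, with `HasSum (j ↦ c_j·g^j) Φ` (Φ = φ(g)).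
Then for every N
`‖Φ − Σ_{n<N} (Σ_{j≤n} c_j·[X^n](mk b)^j)·z^n‖ ≤ 3M·(2·(1 + (C + 3L)∕ρ)·max(K, E) + C·K∕ρ)^N·N!·‖z‖^N`:
finite part `Σ_{j<N} c_j·(g^j − T_N g^j)` by `gevrey_pow` with `Σ_{j<N} ((C+3L)∕ρ)^j ≤ N·(1 + (C+3L)∕ρ)^N ≤ (2(1 + (C+3L)∕ρ))^N`; tail
`Σ_{j≥N} c_j g^j` by `hasSum_nat_add_iff'` + the geometric majorant `M·(‖g‖∕ρ)^N·Σ 2^{−i}` and `‖g‖ ≤ C·K·‖z‖`.  Instances: φ = exp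
(31b's object), 1∕(a₀ + ·) (32k-a), log(1 + ·) (32m). [folklore; Loday-Richaud 2016, Prop. 1.2.4 ∕ 1.2.12] -/
theorem gevrey_comp {b c : ℕ → ℝ} {C K L E M ρ : ℝ} {g Φ z : ℂ}
    (hb0 : b 0 = 0) (hC : 0 ≤ C) (hK : 0 < K) (hL : 0 ≤ L) (hE : 0 < E) (hM : 0 ≤ M) (hρ : 0 < ρ)
    (hb : ∀ k, |b k| ≤ L * (E ^ k * k !))
    (hg : ∀ N : ℕ, ‖g - ∑ k ∈ range N, ((b k : ℝ) : ℂ) * z ^ k‖ ≤ C * K ^ N * N ! * ‖z‖ ^ N)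
    (hc : ∀ j, |c j| ≤ M / ρ ^ j) (hgρ : 2 * ‖g‖ ≤ ρ)
    (hΦ : HasSum (fun j => ((c j : ℝ) : ℂ) * g ^ j) Φ) (N : ℕ) :
    ‖Φ - ∑ n ∈ range N, ((∑ j ∈ range (n + 1), c j * PowerSeries.coeff n ((PowerSeries.mk b) ^ j) : ℝ) : ℂ) * z ^ n‖
      ≤ 3 * M * (2 * (1 + (C + 3 * L) / ρ) * max K E + C * K / ρ) ^ N * N ! * ‖z‖ ^ N := by
  set Θ : ℝ := C + 3 * L with hΘ
  set Km : ℝ := max K E with hKm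
  have hΘ0 : 0 ≤ Θ := by positivity
  have hKm0 : 0 < Km := lt_max_of_lt_left hK
  have hz : 0 ≤ ‖z‖ := norm_nonneg z
  have hN0 : (0 : ℝ) < N ! := by exact_mod_cast Nat.factorial_pos N
  set Kc : ℝ := 2 * (1 + Θ / ρ) * Km + C * K / ρ with hKc
  have hA0 : 0 ≤ 2 * (1 + Θ / ρ) * Km := by positivity
  have hB0 : 0 ≤ C * K / ρ := by positivity
  have hAKc : 2 * (1 + Θ / ρ) * Km ≤ Kc := by rw [hKc]; linarith
  have hBKc : C * K / ρ ≤ Kc := by rw [hKc]; linarith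
  -- split Φ − T_N = (Φ − Σ_{j<N} c_j g^j) + Σ_{j<N} c_j (g^j − T_N g^j)
  rw [truncComp_eq hb0 c z N]
  have esplit : Φ - ∑ j ∈ range N, ((c j : ℝ) : ℂ)
        * ∑ n ∈ range N, ((PowerSeries.coeff n ((PowerSeries.mk b) ^ j) : ℝ) : ℂ) * z ^ n
      = (Φ - ∑ j ∈ range N, ((c j : ℝ) : ℂ) * g ^ j)
        + ∑ j ∈ range N, ((c j : ℝ) : ℂ)
            * (g ^ j - ∑ n ∈ range N, ((PowerSeries.coeff n ((PowerSeries.mk b) ^ j) : ℝ) : ℂ) * z ^ n) := by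
    simp only [mul_sub, Finset.sum_sub_distrib]
    ring
  rw [esplit]
  -- the tail
  have hgC : ‖g‖ ≤ C * K * ‖z‖ := norm_le_of_order_one hb0 hg
  have hq : ‖g‖ / ρ ≤ 1 / 2 := by rw [div_le_iff₀ hρ]; linarith
  have hq0 : 0 ≤ ‖g‖ / ρ := by positivity
  have htail : ‖Φ - ∑ j ∈ range N, ((c j : ℝ) : ℂ) * g ^ j‖ ≤ 2 * M * (C * K / ρ) ^ N * N ! * ‖z‖ ^ N := by
    have hs := (hasSum_nat_add_iff' (f := fun j => ((c j : ℝ) : ℂ) * g ^ j) N).mpr hΦ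
    have hgeo : HasSum (fun i : ℕ => M * (‖g‖ / ρ) ^ N * (1 / 2 : ℝ) ^ i) (M * (‖g‖ / ρ) ^ N * (1 - 1 / 2)⁻¹) :=
      (hasSum_geometric_of_lt_one (by norm_num) (by norm_num)).mul_left _
    have hbd : ∀ i : ℕ, ‖((c (i + N) : ℝ) : ℂ) * g ^ (i + N)‖ ≤ M * (‖g‖ / ρ) ^ N * (1 / 2 : ℝ) ^ i := by
      intro i
      rw [norm_mul, norm_pow, Complex.norm_real, Real.norm_eq_abs]
      have hρi : 0 < ρ ^ (i + N) := pow_pos hρ _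
      calc |c (i + N)| * ‖g‖ ^ (i + N) ≤ M / ρ ^ (i + N) * ‖g‖ ^ (i + N) :=
            mul_le_mul_of_nonneg_right (hc _) (by positivity)
        _ = M * (‖g‖ / ρ) ^ (i + N) := by rw [div_pow]; field_simp
        _ = M * (‖g‖ / ρ) ^ N * (‖g‖ / ρ) ^ i := by rw [pow_add]; ring
        _ ≤ M * (‖g‖ / ρ) ^ N * (1 / 2 : ℝ) ^ i := by gcongr
    have h1 := hs.norm_le_of_bounded hgeo hbd
    have e2 : M * (‖g‖ / ρ) ^ N * (1 - 1 / 2 : ℝ)⁻¹ = 2 * M * (‖g‖ / ρ) ^ N := by norm_num; ring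
    rw [e2] at h1
    refine h1.trans ?_
    have h3 : (‖g‖ / ρ) ^ N ≤ (C * K / ρ) ^ N * ‖z‖ ^ N := by
      rw [← mul_pow]
      refine pow_le_pow_left₀ hq0 ?_ N
      rw [div_mul_eq_mul_div]
      exact div_le_div_of_nonneg_right hgC hρ.le
    calc 2 * M * (‖g‖ / ρ) ^ N ≤ 2 * M * ((C * K / ρ) ^ N * ‖z‖ ^ N) := by gcongr
      _ = 2 * M * (C * K / ρ) ^ N * 1 * ‖z‖ ^ N := by ring
      _ ≤ 2 * M * (C * K / ρ) ^ N * N ! * ‖z‖ ^ N := by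
          gcongr; exact_mod_cast Nat.one_le_iff_ne_zero.mpr (Nat.factorial_ne_zero N)
  -- the finite part
  have hpow := gevrey_pow hC hK hL hE hb hg
  have hfin : ‖∑ j ∈ range N, ((c j : ℝ) : ℂ)
        * (g ^ j - ∑ n ∈ range N, ((PowerSeries.coeff n ((PowerSeries.mk b) ^ j) : ℝ) : ℂ) * z ^ n)‖
      ≤ M * (2 * (1 + Θ / ρ) * Km) ^ N * N ! * ‖z‖ ^ N := by
    have hterm : ∀ j ∈ range N, ‖((c j : ℝ) : ℂ)
        * (g ^ j - ∑ n ∈ range N, ((PowerSeries.coeff n ((PowerSeries.mk b) ^ j) : ℝ) : ℂ) * z ^ n)‖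
          ≤ M * (1 + Θ / ρ) ^ N * (Km ^ N * N ! * ‖z‖ ^ N) := by
      intro j hj
      have hjN : j ≤ N := (Finset.mem_range.mp hj).le
      rw [norm_mul, Complex.norm_real, Real.norm_eq_abs]
      have hρj : 0 < ρ ^ j := pow_pos hρ j
      calc |c j| * ‖g ^ j - ∑ n ∈ range N, ((PowerSeries.coeff n ((PowerSeries.mk b) ^ j) : ℝ) : ℂ) * z ^ n‖
          ≤ M / ρ ^ j * (Θ ^ j * Km ^ N * N ! * ‖z‖ ^ N) :=
            mul_le_mul (hc j) (hpow j N) (norm_nonneg _) (by positivity)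
        _ = M * (Θ / ρ) ^ j * (Km ^ N * N ! * ‖z‖ ^ N) := by rw [div_pow]; field_simp
        _ ≤ M * (1 + Θ / ρ) ^ j * (Km ^ N * N ! * ‖z‖ ^ N) := by gcongr; linarith
        _ ≤ M * (1 + Θ / ρ) ^ N * (Km ^ N * N ! * ‖z‖ ^ N) := by
            have hp : (1 + Θ / ρ) ^ j ≤ (1 + Θ / ρ) ^ N :=
              pow_le_pow_right₀ (by linarith [div_nonneg hΘ0 hρ.le]) hjN
            exact mul_le_mul_of_nonneg_right (mul_le_mul_of_nonneg_left hp hM) (by positivity)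
    refine (norm_sum_le _ _).trans ((Finset.sum_le_sum hterm).trans ?_)
    rw [Finset.sum_const, Finset.card_range, nsmul_eq_mul]
    have hN2 : (N : ℝ) ≤ 2 ^ N := by exact_mod_cast Nat.lt_two_pow_self.le
    calc (N : ℝ) * (M * (1 + Θ / ρ) ^ N * (Km ^ N * N ! * ‖z‖ ^ N))
        ≤ 2 ^ N * (M * (1 + Θ / ρ) ^ N * (Km ^ N * N ! * ‖z‖ ^ N)) := by gcongr
      _ = M * (2 * (1 + Θ / ρ) * Km) ^ N * N ! * ‖z‖ ^ N := by rw [mul_pow, mul_pow]; ring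
  -- assemble
  have hA : (2 * (1 + Θ / ρ) * Km) ^ N ≤ Kc ^ N := pow_le_pow_left₀ hA0 hAKc N
  have hB : (C * K / ρ) ^ N ≤ Kc ^ N := pow_le_pow_left₀ hB0 hBKc N
  calc ‖(Φ - ∑ j ∈ range N, ((c j : ℝ) : ℂ) * g ^ j)
        + ∑ j ∈ range N, ((c j : ℝ) : ℂ)
            * (g ^ j - ∑ n ∈ range N, ((PowerSeries.coeff n ((PowerSeries.mk b) ^ j) : ℝ) : ℂ) * z ^ n)‖
      ≤ 2 * M * (C * K / ρ) ^ N * N ! * ‖z‖ ^ N + M * (2 * (1 + Θ / ρ) * Km) ^ N * N ! * ‖z‖ ^ N :=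
        (norm_add_le _ _).trans (add_le_add htail hfin)
    _ ≤ 2 * M * Kc ^ N * N ! * ‖z‖ ^ N + M * Kc ^ N * N ! * ‖z‖ ^ N := by gcongr
    _ = 3 * M * Kc ^ N * N ! * ‖z‖ ^ N := by ring

/-! ## §4 The three instances of the lineage: exp (31b), the reciprocal (32k-a), the logarithm (32m) -/

/-- **exp OF A GEVREY-1 EXPANSION (the rule behind 31b).**  With b₀ = 0 and `2‖g‖ ≤ 1`: `exp g` has the Gevrey-1 expansion with
letters `Σ_{j≤n} (1∕j!)·[X^n](mk b)^j` and constants `3·(2(1 + C + 3L)·max(K, E) + C·K)^N·N!` (`gevrey_comp` with c_j = 1∕j!, M = ρ = 1;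
Mathlib `NormedSpace.expSeries_div_hasSum_exp`, `Complex.exp_eq_exp_ℂ`). [folklore] -/
theorem gevrey_exp_comp {b : ℕ → ℝ} {C K L E : ℝ} {g z : ℂ}
    (hb0 : b 0 = 0) (hC : 0 ≤ C) (hK : 0 < K) (hL : 0 ≤ L) (hE : 0 < E)
    (hb : ∀ k, |b k| ≤ L * (E ^ k * k !))
    (hg : ∀ N : ℕ, ‖g - ∑ k ∈ range N, ((b k : ℝ) : ℂ) * z ^ k‖ ≤ C * K ^ N * N ! * ‖z‖ ^ N)
    (hg1 : 2 * ‖g‖ ≤ 1) (N : ℕ) :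
    ‖Complex.exp g - ∑ n ∈ range N,
        ((∑ j ∈ range (n + 1), (1 / (j ! : ℝ)) * PowerSeries.coeff n ((PowerSeries.mk b) ^ j) : ℝ) : ℂ) * z ^ n‖
      ≤ 3 * (2 * (1 + (C + 3 * L)) * max K E + C * K) ^ N * N ! * ‖z‖ ^ N := by
  have hΦ : HasSum (fun j => (((1 / (j ! : ℝ) : ℝ)) : ℂ) * g ^ j) (Complex.exp g) := by
    have h := NormedSpace.expSeries_div_hasSum_exp g
    rw [← congr_fun Complex.exp_eq_exp_ℂ g] at h
    refine h.congr_fun fun j => ?_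
    push_cast
    ring
  have hc : ∀ j : ℕ, |(1 / (j ! : ℝ))| ≤ 1 / (1 : ℝ) ^ j := by
    intro j
    rw [one_pow, abs_of_pos (by positivity), div_le_div_iff₀ (by positivity) one_pos, one_mul, one_mul]
    exact_mod_cast Nat.one_le_iff_ne_zero.mpr (Nat.factorial_ne_zero j)
  have h := gevrey_comp hb0 hC hK hL hE zero_le_one one_pos hb hg hc (by simpa using hg1) hΦ N
  simpa only [div_one, one_mul, mul_one] using h

/-- **THE RECIPROCAL 1∕(1 + g) OF A GEVREY-1 EXPANSION (the rule behind 32k-a, normalised leading letter).**  With b₀ = 0 and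
`2‖g‖ ≤ 1`: `(1 + g)⁻¹ = Σ (−1)^j g^j` has the Gevrey-1 expansion with letters `Σ_{j≤n} (−1)^j·[X^n](mk b)^j` and constants
`3·(2(1 + C + 3L)·max(K, E) + C·K)^N·N!` (`gevrey_comp` with c_j = (−1)^j; Mathlib `hasSum_geometric_of_norm_lt_one` at ξ = −g). [folklore] -/
theorem gevrey_inv_comp {b : ℕ → ℝ} {C K L E : ℝ} {g z : ℂ}
    (hb0 : b 0 = 0) (hC : 0 ≤ C) (hK : 0 < K) (hL : 0 ≤ L) (hE : 0 < E)
    (hb : ∀ k, |b k| ≤ L * (E ^ k * k !))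
    (hg : ∀ N : ℕ, ‖g - ∑ k ∈ range N, ((b k : ℝ) : ℂ) * z ^ k‖ ≤ C * K ^ N * N ! * ‖z‖ ^ N)
    (hg1 : 2 * ‖g‖ ≤ 1) (N : ℕ) :
    ‖(1 + g)⁻¹ - ∑ n ∈ range N,
        ((∑ j ∈ range (n + 1), (-1 : ℝ) ^ j * PowerSeries.coeff n ((PowerSeries.mk b) ^ j) : ℝ) : ℂ) * z ^ n‖
      ≤ 3 * (2 * (1 + (C + 3 * L)) * max K E + C * K) ^ N * N ! * ‖z‖ ^ N := by
  have hlt : ‖-g‖ < 1 := by rw [norm_neg]; linarith [norm_nonneg g]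
  have hΦ : HasSum (fun j => ((((-1 : ℝ) ^ j : ℝ)) : ℂ) * g ^ j) ((1 + g)⁻¹) := by
    have h := hasSum_geometric_of_norm_lt_one hlt
    rw [sub_neg_eq_add] at h
    refine h.congr_fun fun j => ?_
    rw [neg_pow g j]
    push_cast
    ring
  have hc : ∀ j : ℕ, |(-1 : ℝ) ^ j| ≤ 1 / (1 : ℝ) ^ j := by
    intro j; simp
  have h := gevrey_comp hb0 hC hK hL hE zero_le_one one_pos hb hg hc (by simpa using hg1) hΦ N
  simpa only [div_one, one_mul, mul_one] using h

/-- **THE LOGARITHM log(1 + g) OF A GEVREY-1 EXPANSION (the rule behind 32m).**  With b₀ = 0 and `2‖g‖ ≤ 1`: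
`log(1 + g) = Σ_{j≥1} (−1)^{j+1} g^j∕j` has the Gevrey-1 expansion with letters `Σ_{j≤n} ((−1)^{j+1}∕j)·[X^n](mk b)^j` (the j = 0
letter is 0) and constants `3·(2(1 + C + 3L)·max(K, E) + C·K)^N·N!` (`gevrey_comp`; Mathlib `Complex.hasSum_taylorSeries_log`). [folklore] -/
theorem gevrey_log_comp {b : ℕ → ℝ} {C K L E : ℝ} {g z : ℂ}
    (hb0 : b 0 = 0) (hC : 0 ≤ C) (hK : 0 < K) (hL : 0 ≤ L) (hE : 0 < E)
    (hb : ∀ k, |b k| ≤ L * (E ^ k * k !))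
    (hg : ∀ N : ℕ, ‖g - ∑ k ∈ range N, ((b k : ℝ) : ℂ) * z ^ k‖ ≤ C * K ^ N * N ! * ‖z‖ ^ N)
    (hg1 : 2 * ‖g‖ ≤ 1) (N : ℕ) :
    ‖Complex.log (1 + g) - ∑ n ∈ range N,
        ((∑ j ∈ range (n + 1), ((-1 : ℝ) ^ (j + 1) / j) * PowerSeries.coeff n ((PowerSeries.mk b) ^ j) : ℝ) : ℂ) * z ^ n‖
      ≤ 3 * (2 * (1 + (C + 3 * L)) * max K E + C * K) ^ N * N ! * ‖z‖ ^ N := by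
  have hlt : ‖g‖ < 1 := by linarith [norm_nonneg g]
  have hΦ : HasSum (fun j : ℕ => ((((-1 : ℝ) ^ (j + 1) / (j : ℝ) : ℝ)) : ℂ) * g ^ j) (Complex.log (1 + g)) := by
    have h := Complex.hasSum_taylorSeries_log hlt
    refine h.congr_fun fun j => ?_
    push_cast
    ring
  have hc : ∀ j : ℕ, |(-1 : ℝ) ^ (j + 1) / j| ≤ 1 / (1 : ℝ) ^ j := by
    intro j
    rw [one_pow, div_one, abs_div, abs_pow, abs_neg, abs_one, one_pow]
    rcases Nat.eq_zero_or_pos j with h0 | hpos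
    · subst h0; simp
    · rw [Nat.abs_cast, div_le_one (by exact_mod_cast hpos)]
      exact_mod_cast hpos
  have h := gevrey_comp hb0 hC hK hL hE zero_le_one one_pos hb hg hc (by simpa using hg1) hΦ N
  simpa only [div_one, one_mul, mul_one] using h

end Summit.QuantumFields.BalabanUV.Beta.EriceFlowEnclosureGevreyComposition
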